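import Mathlib.Algebra.BigOperators.Fin
import Mathlib.Data.Complex.Basic
import Literature.Computability.AlgebraicComplexity.StandardFamilies
import Literature.Computability.AlgebraicComplexity.HessianAtOrigin
import HarnessLib

/-!
# Crux `GrenetZeon.HessianRankCodimTwo` (stmt-ValiantsHypothesis-8061), line `good_plane`,
# stub `stub_goodPlanes` — the (bordered) LATIN BLOCK PLANE: definitions

The registered stub `stub_goodPlanes : ∃ n₀, ∀ n ≥ n₀, GoodPlane n` of
`Cruxes/HessianRankCodimTwo/Lines/good_plane.lean` asks for ONE explicit projective plane of
`n × n` matrices missing the half-rank locus `B_n = {per_n = 0, rank Hess per_n ≤ n²/2}` for every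
large `n`.  This file fixes the candidate (seat val-width-8061-p2, 2026-08-27): for `n = 3m + r`,
`r ∈ {0,1,2}`, the plane spanned by the three matrices `latinBasis m r d` (`d < 3`), whose general
point `latinPoint m r a = Σ_d a_d · latinBasis m r d` is the block matrix

  `[[ circ(a_0,a_1,a_2) ⊗ J_m ,  U ⊗ 1_m ], [ V ⊗ 1_mᵀ ,  W ]]`

(three big row/column classes of size `m` on which the matrix is block-constant with the circulant
pattern `a_{J-I}`, and `r` border rows/columns with the linear forms
`U = (a_I | a_{I+1})_I`, `V = (a_J | a_{J+2})_J`, `W = [[Σa, a_0-a_1],[a_1-a_2, Σa]]`, chosen so that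
no point of the plane has a zero row/column or a Frobenius–König zero block), together with the
nine BLOCK VALUES `latinBlockValue m r hm a I J` — the Hessian entries of `per_n` at two rows of big
block `I` and two columns of big block `J`, i.e. the `(n-2) × (n-2)` sub-permanents of the point —
and the residual statement `LatinBlockNonvanishing m r` ((★): on the curve `per_n = 0` of the plane
at least six of the nine block values are non-zero).

Why this is the right residual: by the block-eigenvector theorem
(`Theorems/GrenetZeonHessianRankCodimTwoBlockEigen.lean`) each non-zero block value contributes an
eigenspace of dimension `(m-1)²`, so (★) gives `rank Hess ≥ 6(m-1)² > n²/2` for `m ≥ 12`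
(`Theorems/GrenetZeonHessianRankCodimTwoLatinPlane.lean`: `LatinBlockNonvanishing` for all large
`m` and all `r < 3` implies `stub_goodPlanes`).  (★) is OPEN uniformly in `m`; it was verified by
exact elimination (resultants modulo the prime `2³¹ - 1` after a generic shear, plus the boundary
lines) for `(r, m) ∈ {0} × [2,8] ∪ {1} × [3,6] ∪ {2} × [3,5]`; dead alternatives (torus-weight
planes, `S_{n-1}`-invariant planes, band/bidiagonal pencils, balanced direct sums, forest-support
block planes, three big blocks of unequal sizes) are recorded in the seat notes.  Nothing is proved
here.  VP ≠ VNP is not moved: the crux only feeds the constant-factor bound `TwoDimCoefficients`.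
-/

noncomputable section

open Literature.Computability.AlgebraicComplexity

-- single-conjunct layout `Summits/ValiantsHypothesis/ValiantsHypothesis`: duplicated namespace by design
set_option linter.dupNamespace false

namespace Summit.ValiantsHypothesis.ValiantsHypothesis.Theorems.GrenetZeonHessianRankCodimTwo

/-- Corner pattern of the `2 × 2` border block `[[a+b+c, a-b],[b-c, a+b+c]]` of the bordered Latin
block plane: the coefficient of the coordinate `x_d` at border position `(s, s')`. [folklore] -/
def latinCorner (s s' : ℕ) (d : Fin 3) : ℂ :=
  if s = s' then 1
  else if s = 0 then (if d = 0 then 1 else if d = 1 then -1 else 0)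
  else (if d = 1 then 1 else if d = 2 then -1 else 0)

/-- The three basis matrices `w_0, w_1, w_2` of the (bordered) LATIN BLOCK PLANE of size
`n = 3m + r`: the point `Σ_d a_d w_d` is the block matrix
`[[circ(a_0,a_1,a_2) ⊗ J_m, U ⊗ 1_m],[V ⊗ 1_mᵀ, W]]` with three big blocks of size `m` (block
`(I, J)` constant `= a_{J-I mod 3}`), `r ≤ 2` border columns `U = ((a_I)_I, (a_{I+1})_I)`, border
rows `V = ((a_J)_J, (a_{J+2})_J)` and corner `W = [[a_0+a_1+a_2, a_0-a_1],[a_1-a_2, a_0+a_1+a_2]]`.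
[folklore] -/
def latinBasis (m r : ℕ) (d : Fin 3) : Fin (3 * m + r) × Fin (3 * m + r) → ℂ := fun p =>
  if p.1.val < 3 * m then
    if p.2.val < 3 * m then (if (p.1.val / m + d.val) % 3 = p.2.val / m then 1 else 0)
    else (if (p.1.val / m + (p.2.val - 3 * m)) % 3 = d.val then 1 else 0)
  else
    if p.2.val < 3 * m then (if (p.2.val / m + 2 * (p.1.val - 3 * m)) % 3 = d.val then 1 else 0)
    else latinCorner (p.1.val - 3 * m) (p.2.val - 3 * m) d

/-- The point of the Latin block plane with coordinates `a = (a_0, a_1, a_2)`. [folklore] -/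
def latinPoint (m r : ℕ) (a : Fin 3 → ℂ) : Fin (3 * m + r) × Fin (3 * m + r) → ℂ :=
  ∑ d, a d • latinBasis m r d

/-- Row/column index number `s` of big block `I` (`I < 3`, `s < m`), as an element of
`Fin (3m + r)`. [folklore] -/
def blockIdx (m r : ℕ) (hm : 2 ≤ m) (I : Fin 3) (s : Fin 2) : Fin (3 * m + r) :=
  ⟨I.val * m + s.val, by have := I.isLt; have := s.isLt; nlinarith⟩

/-- The BLOCK VALUE `h_{IJ}(a)` of the Latin block plane: the Hessian entry of `per_n` at the
point with coordinates `a`, at the positions (row `I·m`, column `J·m`) and (row `I·m + 1`, column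
`J·m + 1`) — i.e. the `(n-2) × (n-2)` sub-permanent of the point with two rows of big block `I`
and two columns of big block `J` removed (`hess0_transl_perPoly`). [folklore] -/
def latinBlockValue (m r : ℕ) (hm : 2 ≤ m) (a : Fin 3 → ℂ) (I J : Fin 3) : ℂ :=
  hess0 (transl (latinPoint m r a) (perPoly (Fin (3 * m + r)) ℂ))
    (blockIdx m r hm I 0, blockIdx m r hm J 0) (blockIdx m r hm I 1, blockIdx m r hm J 1)

/-- **(★) Latin block non-vanishing at size `(m, r)`.** At every point of the Latin block plane of
size `n = 3m + r` lying on the permanental hypersurface, at least six of the nine block values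
`h_{IJ}` are non-zero.  OPEN uniformly in `m`; verified by exact computation (resultants) for
`r = 0, m ≤ 8`, `r = 1, m ≤ 6`, `r = 2, m ≤ 5` (seat val-width-8061-p2, 2026-08-27); for `r = 0`
the cyclic block symmetry makes it "at most one of the three values `η_0, η_1, η_2` vanishes".
[folklore] -/
def LatinBlockNonvanishing (m r : ℕ) : Prop :=
  ∀ hm : 2 ≤ m, ∀ a : Fin 3 → ℂ, a ≠ 0 →
    MvPolynomial.eval (latinPoint m r a) (perPoly (Fin (3 * m + r)) ℂ) = 0 →
      6 ≤ (Finset.univ.filter fun IJ : Fin 3 × Fin 3 =>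
        latinBlockValue m r hm a IJ.1 IJ.2 ≠ 0).card

end Summit.ValiantsHypothesis.ValiantsHypothesis.Theorems.GrenetZeonHessianRankCodimTwo
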